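import Literature.Analysis.FluidPDE.PassiveVectorVarTensorLionsWeak
import Literature.Analysis.FluidPDE.PassiveVectorVarTensorLionsGradient
import Literature.Analysis.FluidPDE.TorusClassicalLerayHopfProofs
import HarnessLib

/-!
# Lions' theorem in the GRAPH space `(ψ, ∇ψ)`: the damped weak solution of the variable-tensor
# passive-vector equation comes with a weak space-gradient in `L²((0,T) × T^d)` (`L²ₜH¹ₓ`)

Analysis/FluidPDE file (everything proved; no definitions, no named facts). Second pass of J.-L. Lions'
projection theorem (`OperatorTheory.LionsProjection`; Lions–Magenes 1972, Chap. 3, Thm. 1.1, §4.3–§4.4)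
for the damped weak formulation of `∂ₜw + (b·∇)w + ∇π = ∇·(𝔹(t,y)∇w)`, `∇·w = 0` on `T^d × (0,T)` — the
companion of `PassiveVectorVarTensorLionsWeak.exists_dampedWeakVar_mem_closure` — run not in
`L²(μ_T)` but in the GRAPH space: the divergence-free space–time tests are embedded as
`j ψ = (ψ, ∂₁ψ, …, ∂_dψ)` into `L²(μ_T; G)`, `G = Π₂_{o ∈ Option d} ℝ^d` (coordinate `none` = the
value, `some c` = the `c`-th partial derivative), with the size function
`q(ψ)² = ‖ψ‖²_{L²(μ_T)} + (lo − (card d)²δ)·∫_{(0,T)}‖∇ψ(t)‖₂² + ½‖ψ(0)‖²`. The form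
`E(U, ψ) = −⟪L_𝔹 ψ, U_none⟫_{L²}` is coercive for THIS `q` by the perturbative Gårding inequality WITH
its gradient term (`PassiveVectorVarTensorGarding.integral_inner_viscAdjVar_self_le`: this is where
STRICT ellipticity `(card d)²δ < lo` enters — Lions–Magenes' hypothesis (4.12)/(4.20) that the form
controls the `V = H¹`-norm), so Lions' theorem returns `U ∈ L²(μ_T; G)` in the CLOSED SPAN of
`j(tests)`: its value component `v = U_none` is a damped `L²` weak solution, and `U` carries, by
construction, the `L²(μ_T)` fields `U_{some c}` which on `j(tests)` are the partial derivatives of the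
value — the closed linear relation "`U_{some c}` is the weak `c`-th derivative of `U_none`" passes to
the closure (extraction, slice-wise, in the sequel; same mechanism as
`PassiveVectorLionsExtract.ae_isWeaklyDivFree_of_mem_closure`). This is the `L²ₜH¹ₓ` regularity of
the Lions solution that the variable-coefficient energy argument needs (the tensor cannot be moved
across the Fourier truncation without one derivative on the solution).

* `setIntegral_varTensorForm_ge'` — the coercive form WITH the gradient term:
  `∫∫‖ψ‖² + (lo − (card d)²δ)∫‖∇ψ‖² + ½‖ψ(0)‖² ≤ −∫∫⟪ψ, ∂ₜψ − ψ + (b·∇)ψ + 𝓛^{𝔹,*}ψ⟫`;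
* `exists_dampedWeakVar_graph` — the Lions solution in the graph space.

Consumer: cell `ad-ideate`, K1L_D `stmt-AnomalousDissipation-27980`, lead memo L9 §5 Z7α (tenure ruling
2026-08-29T02:36:59Z: the existence theorem must output `L²ₜH¹ₓ` + the energy inequality).

## Mathlib / tree search

Tree: `PassiveVectorVarTensorLionsWeak` (the `L²` pass: `memLp_two_dampedOpVar`, `dampedOpVar_add/_const_smul`,
the form without gradient), `PassiveVectorVarTensorGarding.integral_inner_viscAdjVar_self_le`,
`IsSmoothSpaceTimeOn.continuousOn_gradNormSq` (`TorusClassicalLerayHopfProofs`),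
`OperatorTheory.LionsProjection.exists_eq_of_coercive`. Mathlib: `PiLp 2` over `Option d`
(`PiLp.proj`, `PiLp.norm_sq_eq_of_L2`, `Fintype.sum_option`), `ContinuousLinearMap.compLpL`,
`ContinuousLinearMap.coeFn_compLpL`, `MeasureTheory.L2.inner_def`.

## References

* J.-L. Lions, E. Magenes, *Non-homogeneous boundary value problems and applications* I (1972), Chap. 3,
  Thm. 1.1, §4.3 (4.12), §4.4 (4.20)–(4.21). [`LionsMagenes1972`]
* M. Giaquinta, *Multiple integrals in the calculus of variations* (Princeton 1983), Ch. III §2 (2.2)–(2.6). [`Giaquinta1983MultipleIntegrals`]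
-/

noncomputable section

open MeasureTheory Set Filter Function TopologicalSpace
open scoped ENNReal NNReal InnerProductSpace Topology

namespace Literature.Analysis.FluidPDE

namespace Torus

variable {d : Type*} [Fintype d] [DecidableEq d]

/-! ## Divergence-free tests form a subspace (private copies) -/

/-- Smooth divergence-free fields are closed under addition. [folklore] -/
private theorem isDivFree_add₃₀ {u v : UnitAddTorus d → EuclideanSpace ℝ d}
    (hu : FunctionSpaces.Torus.IsSmooth u) (hv : FunctionSpaces.Torus.IsSmooth v)
    (hud : FunctionSpaces.Torus.IsDivFree u) (hvd : FunctionSpaces.Torus.IsDivFree v) :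
    FunctionSpaces.Torus.IsDivFree (u + v) := by
  intro x
  have hu1 : ∀ i, FunctionSpaces.Torus.IsContDiff 1 (fun y => u y i) := fun i =>
    (hu.apply i).isContDiff (by simp)
  have hv1 : ∀ i, FunctionSpaces.Torus.IsContDiff 1 (fun y => v y i) := fun i =>
    (hv.apply i).isContDiff (by simp)
  have h : ∀ i, FunctionSpaces.Torus.partialDeriv i (fun y => (u + v) y i) x =
      FunctionSpaces.Torus.partialDeriv i (fun y => u y i) x + FunctionSpaces.Torus.partialDeriv i (fun y => v y i) x := by
    intro i
    have e : (fun y => (u + v) y i) = (fun y => u y i) + fun y => v y i := by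
      funext y; simp
    rw [e, FunctionSpaces.Torus.partialDeriv_add (hu1 i) (hv1 i)]
    rfl
  unfold FunctionSpaces.Torus.divergence
  simp_rw [h]
  rw [Finset.sum_add_distrib]
  have h0 := hud x
  have h1 := hvd x
  unfold FunctionSpaces.Torus.divergence at h0 h1
  rw [h0, h1, add_zero]

/-- Smooth divergence-free fields: the zero field is divergence free. [folklore] -/
private theorem isDivFree_zero₃₀ : FunctionSpaces.Torus.IsDivFree (0 : UnitAddTorus d → EuclideanSpace ℝ d) := by
  intro x
  simp [FunctionSpaces.Torus.divergence, FunctionSpaces.Torus.partialDeriv, FunctionSpaces.Torus.lineDeriv]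

omit [Fintype d] in
/-- `∂ᵢ (c f) = c ∂ᵢ f` for real functions on `T^d`. [folklore] -/
private theorem partialDeriv_const_mul₃₀ (c : ℝ) (f : UnitAddTorus d → ℝ) (i : d) (x : UnitAddTorus d) :
    FunctionSpaces.Torus.partialDeriv i (fun y => c * f y) x = c * FunctionSpaces.Torus.partialDeriv i f x := by
  simp only [FunctionSpaces.Torus.partialDeriv, FunctionSpaces.Torus.lineDeriv, deriv_const_mul_field']

/-- A constant multiple of a divergence-free field is divergence free. [folklore] -/
private theorem isDivFree_const_smul₃₀ {G : UnitAddTorus d → EuclideanSpace ℝ d}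
    (hG : FunctionSpaces.Torus.IsDivFree G) (c : ℝ) : FunctionSpaces.Torus.IsDivFree (c • G) := by
  intro x
  have h : ∀ i : d, FunctionSpaces.Torus.partialDeriv i (fun y => (c • G) y i) x =
      c * FunctionSpaces.Torus.partialDeriv i (fun y => G y i) x := by
    intro i
    have e : (fun y => (c • G) y i) = fun y => c * G y i := by
      funext y; simp [Pi.smul_apply, smul_eq_mul]
    rw [e, partialDeriv_const_mul₃₀]
  unfold FunctionSpaces.Torus.divergence
  simp_rw [h]
  rw [← Finset.mul_sum]
  have h0 := hG x
  unfold FunctionSpaces.Torus.divergence at h0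
  rw [h0, mul_zero]


/-! ## §1 The coercive form with the gradient term -/

/-- **Coercivity of the damped variable-tensor form WITH the gradient term** (Lions–Magenes 1972,
Chap. 3, (4.20)–(4.21) with the `V`-ellipticity (4.12) kept on the left): for `T > 0`, `NearIso 𝔸 lo hi`,
`|𝔹 − 𝔸| ≤ δ` entrywise, a bounded carrier weakly divergence free at a.e. time and a divergence-free
space–time test `ψ`,
`∫_{(0,T)}∫‖ψ‖² + (lo − (card d)²δ) ∫_{(0,T)} ‖∇ψ(t)‖₂² + ½∫‖ψ(0)‖² ≤ −∫_{(0,T)}∫⟪ψ, ∂ₜψ − ψ + (b·∇)ψ + 𝓛^{𝔹,*}ψ⟫`.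
[cite: LionsMagenes1972, Chap. 3 Thm. 1.1 and §4.3] [cite: Giaquinta1983MultipleIntegrals, Ch. III §2 eq. (2.2)–(2.6)] -/
theorem setIntegral_varTensorForm_ge' {T : ℝ} (hT : 0 < T) {𝔸 : Visc4 d} {lo hi : ℝ} (h𝔸 : NearIso 𝔸 lo hi)
    {𝔹 : ℝ → UnitAddTorus d → Visc4 d}
    (h𝔹s : ∀ t i c j e, FunctionSpaces.Torus.IsSmooth (fun y => 𝔹 t y i c j e))
    (h𝔹c : ∀ i c j e, Continuous (uncurry fun t y => 𝔹 t y i c j e))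
    (h𝔹d : ∀ i c j e e', Continuous (uncurry fun t y =>
      FunctionSpaces.Torus.partialDeriv e' (fun y => 𝔹 t y i c j e) y))
    {δ : ℝ} (hδ : ∀ t y i c j e, |𝔹 t y i c j e - 𝔸 i c j e| ≤ δ) 
    {b ψ : ℝ → UnitAddTorus d → EuclideanSpace ℝ d} (hψ : FunctionSpaces.Torus.IsSpaceTimeTest T ψ)
    (hψdiv : FunctionSpaces.Torus.IsDivFreeTest ψ)
    (hbdiv : ∀ᵐ t ∂(volume.restrict (Ioo 0 T)), FunctionSpaces.Torus.IsWeaklyDivFree (b t))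
    (hbm : AEStronglyMeasurable (uncurry b) (((volume : Measure ℝ).restrict (Ioo 0 T)).prod volume)) {M : ℝ}
    (hbM : ∀ᵐ p ∂(((volume : Measure ℝ).restrict (Ioo 0 T)).prod (volume : Measure (UnitAddTorus d))),
      ‖uncurry b p‖ ≤ M) :
    (∫ t in Ioo 0 T, ∫ x, ‖ψ t x‖ ^ 2) +
        (lo - (Fintype.card d : ℝ) ^ 2 * δ) * (∫ t in Ioo 0 T, FunctionSpaces.Torus.gradNormSq (ψ t)) +
        (1 / 2) * ∫ x, ‖ψ 0 x‖ ^ 2 ≤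
      -(∫ t in Ioo 0 T, ∫ x, ⟪ψ t x, FunctionSpaces.Torus.timeDeriv ψ t x - ψ t x +
          FunctionSpaces.Torus.convect (b t) (ψ t) x + viscAdjVar (𝔹 t) (ψ t) x⟫_ℝ) := by
  -- slice integrability
  have hcψ : Continuous (uncurry ψ) := hψ.continuous_uncurry
  have hVc : Continuous (uncurry fun t x => viscAdjVar (𝔹 t) (ψ t) x) :=
    continuous_uncurry_viscAdjVar (fun t i c l e => (h𝔹s t i c l e).isContDiff (by simp)) h𝔹c h𝔹d
      hψ.isSmooth_slice hψ.isLipschitzSpaceTimeTest.continuous_uncurry_iterPartialDeriv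
  have iA : ∀ t, Integrable (fun x => ⟪ψ t x, FunctionSpaces.Torus.timeDeriv ψ t x⟫_ℝ) volume := fun t =>
    ((hψ.isSmooth_slice t).continuous.inner (hψ.timeDeriv.isSmooth_slice t).continuous).integrable_of_hasCompactSupport
      (HasCompactSupport.of_compactSpace _)
  have iS : ∀ t, Integrable (fun x => ⟪ψ t x, ψ t x⟫_ℝ) volume := fun t =>
    ((hψ.isSmooth_slice t).continuous.inner (hψ.isSmooth_slice t).continuous).integrable_of_hasCompactSupport
      (HasCompactSupport.of_compactSpace _)
  have iL : ∀ t, Integrable (fun x => ⟪ψ t x, viscAdjVar (𝔹 t) (ψ t) x⟫_ℝ) volume := fun t =>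
    ((hψ.isSmooth_slice t).continuous.inner (isSmooth_viscAdjVar (h𝔹s t) (hψ.isSmooth_slice t)).continuous).integrable_of_hasCompactSupport
      (HasCompactSupport.of_compactSpace _)
  have hprod := integrable_inner_convect_self_prod hψ hbm hbM
  have iC : ∀ᵐ t ∂(volume.restrict (Ioo 0 T)),
      Integrable (fun x => ⟪ψ t x, FunctionSpaces.Torus.convect (b t) (ψ t) x⟫_ℝ) volume := hprod.prod_right_ae
  -- the slice identity
  have hslice : ∀ᵐ t ∂(volume.restrict (Ioo 0 T)),
      ∫ x, ⟪ψ t x, FunctionSpaces.Torus.timeDeriv ψ t x - ψ t x +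
          FunctionSpaces.Torus.convect (b t) (ψ t) x + viscAdjVar (𝔹 t) (ψ t) x⟫_ℝ =
        (∫ x, ⟪ψ t x, FunctionSpaces.Torus.timeDeriv ψ t x⟫_ℝ) - (∫ x, ‖ψ t x‖ ^ 2) +
          (∫ x, ⟪ψ t x, FunctionSpaces.Torus.convect (b t) (ψ t) x⟫_ℝ) +
            ∫ x, ⟪ψ t x, viscAdjVar (𝔹 t) (ψ t) x⟫_ℝ := by
    filter_upwards [iC] with t ht
    have e : (fun x => ⟪ψ t x, FunctionSpaces.Torus.timeDeriv ψ t x - ψ t x +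
        FunctionSpaces.Torus.convect (b t) (ψ t) x + viscAdjVar (𝔹 t) (ψ t) x⟫_ℝ) =
        fun x => ⟪ψ t x, FunctionSpaces.Torus.timeDeriv ψ t x⟫_ℝ - ⟪ψ t x, ψ t x⟫_ℝ +
          ⟪ψ t x, FunctionSpaces.Torus.convect (b t) (ψ t) x⟫_ℝ + ⟪ψ t x, viscAdjVar (𝔹 t) (ψ t) x⟫_ℝ := by
      funext x
      rw [inner_add_right, inner_add_right, inner_sub_right]
    have h12 : Integrable (fun x => ⟪ψ t x, FunctionSpaces.Torus.timeDeriv ψ t x⟫_ℝ - ⟪ψ t x, ψ t x⟫_ℝ) volume :=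
      (iA t).sub (iS t)
    have h123 : Integrable (fun x => ⟪ψ t x, FunctionSpaces.Torus.timeDeriv ψ t x⟫_ℝ - ⟪ψ t x, ψ t x⟫_ℝ +
        ⟪ψ t x, FunctionSpaces.Torus.convect (b t) (ψ t) x⟫_ℝ) volume := h12.add ht
    rw [e, integral_add h123 (iL t), integral_add h12 ht, integral_sub (iA t) (iS t),
      integral_congr_ae (ae_of_all _ fun x => real_inner_self_eq_norm_sq (ψ t x))]
  -- time integrability of the four slice terms
  have IA : IntegrableOn (fun t => ∫ x, ⟪ψ t x, FunctionSpaces.Torus.timeDeriv ψ t x⟫_ℝ) (Ioo 0 T) :=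
    integrableOn_integral_inner_of_continuous hψ hψ.timeDeriv.continuous_uncurry
  have IS : IntegrableOn (fun t => ∫ x, ‖ψ t x‖ ^ 2) (Ioo 0 T) := by
    refine (integrableOn_integral_inner_of_continuous hψ hcψ).congr (ae_of_all _ fun t => ?_)
    exact integral_congr_ae (ae_of_all _ fun x => real_inner_self_eq_norm_sq (ψ t x))
  have IC : IntegrableOn (fun t => ∫ x, ⟪ψ t x, FunctionSpaces.Torus.convect (b t) (ψ t) x⟫_ℝ) (Ioo 0 T) :=
    hprod.integral_prod_left
  have IL : IntegrableOn (fun t => ∫ x, ⟪ψ t x, viscAdjVar (𝔹 t) (ψ t) x⟫_ℝ) (Ioo 0 T) :=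
    integrableOn_integral_inner_of_continuous hψ hVc
  -- assemble
  have H12 : IntegrableOn (fun t => (∫ x, ⟪ψ t x, FunctionSpaces.Torus.timeDeriv ψ t x⟫_ℝ) - ∫ x, ‖ψ t x‖ ^ 2) (Ioo 0 T) :=
    IA.sub IS
  have H123 : IntegrableOn (fun t => (∫ x, ⟪ψ t x, FunctionSpaces.Torus.timeDeriv ψ t x⟫_ℝ) - (∫ x, ‖ψ t x‖ ^ 2) +
      ∫ x, ⟪ψ t x, FunctionSpaces.Torus.convect (b t) (ψ t) x⟫_ℝ) (Ioo 0 T) := H12.add IC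
  rw [integral_congr_ae hslice, integral_add H123 IL, integral_add H12 IC, integral_sub IA IS,
    setIntegral_integral_inner_timeDeriv_self hψ hT, setIntegral_integral_inner_convect_self_eq_zero hψ hbdiv]
  -- the viscous term against the gradient: slice-wise perturbative Gårding, integrated in time
  have hGc : Continuous (fun t => FunctionSpaces.Torus.gradNormSq (ψ t)) := by
    have h := (hψ.isSmoothSpaceTimeOn univ).continuousOn_gradNormSq convex_univ uniqueDiffOn_univ
    exact continuousOn_univ.1 h
  have IG : IntegrableOn (fun t => FunctionSpaces.Torus.gradNormSq (ψ t)) (Ioo 0 T) :=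
    (hGc.integrableOn_Icc (a := 0) (b := T)).mono_set Ioo_subset_Icc_self
  have hL0 : ∫ t in Ioo 0 T, ∫ x, ⟪ψ t x, viscAdjVar (𝔹 t) (ψ t) x⟫_ℝ ≤
      -((lo - (Fintype.card d : ℝ) ^ 2 * δ) * ∫ t in Ioo 0 T, FunctionSpaces.Torus.gradNormSq (ψ t)) := by
    rw [← integral_const_mul, ← integral_neg]
    refine setIntegral_mono_on IL (IG.const_mul _).neg measurableSet_Ioo fun t _ => ?_
    exact integral_inner_viscAdjVar_self_le h𝔸 (h𝔹s t) (hδ t) (hψ.isSmooth_slice t) (hψdiv t)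
  linarith


/-! ## §2 Lions' theorem in the graph space -/

set_option maxHeartbeats 1600000 in
/-- **Lions' theorem in the graph space** (Lions–Magenes 1972, Chap. 3, Thm. 1.1 with the `V`-coercive
form of §4.4): for `T > 0`, a coefficient field `𝔹` (smooth slices; `𝔹`, `∂_y𝔹` jointly continuous)
entrywise `δ`-close to `𝔸`, `NearIso 𝔸 lo hi`, STRICT ellipticity `(card d)²δ < lo`, `‖b‖ ≤ M` a.e. with
`b(t)` weakly divergence free for a.e. `t`, and `w₀ ∈ L²`: there is `U ∈ L²(μ_T; Π₂_{Option d} ℝ^d)` in the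
closed span of the graph embeddings `(ψ, ∂₁ψ, …, ∂_dψ)` of the divergence-free space–time tests whose
VALUE component `p ↦ (U p) none` satisfies the damped weak identity
`∫_{μ_T}⟪U_none, ∂ₜψ − ψ + (b·∇)ψ + 𝓛^{𝔹(t),*}ψ⟫ + ∫⟪w₀, ψ(0)⟫ = 0` for all divergence-free tests `ψ`
(the components `p ↦ (U p) (some c)` are, on the embedded tests, the partial derivatives of the value —
the `L²ₜH¹ₓ` information). [cite: LionsMagenes1972, Chap. 3 Thm. 1.1] -/
theorem exists_dampedWeakVar_graph {T : ℝ} (hT : 0 < T) {𝔸 : Visc4 d} {lo hi : ℝ} (h𝔸 : NearIso 𝔸 lo hi)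
    {𝔹 : ℝ → UnitAddTorus d → Visc4 d}
    (h𝔹s : ∀ t i c j e, FunctionSpaces.Torus.IsSmooth (fun y => 𝔹 t y i c j e))
    (h𝔹c : ∀ i c j e, Continuous (uncurry fun t y => 𝔹 t y i c j e))
    (h𝔹d : ∀ i c j e e', Continuous (uncurry fun t y =>
      FunctionSpaces.Torus.partialDeriv e' (fun y => 𝔹 t y i c j e) y))
    {δ : ℝ} (hδ : ∀ t y i c j e, |𝔹 t y i c j e - 𝔸 i c j e| ≤ δ) (hlo : (Fintype.card d : ℝ) ^ 2 * δ < lo)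
    {b : ℝ → UnitAddTorus d → EuclideanSpace ℝ d}
    (hbm : AEStronglyMeasurable (uncurry b) (((volume : Measure ℝ).restrict (Ioo 0 T)).prod volume)) {M : ℝ}
    (hbM : ∀ᵐ p ∂(((volume : Measure ℝ).restrict (Ioo 0 T)).prod (volume : Measure (UnitAddTorus d))),
      ‖uncurry b p‖ ≤ M)
    (hbdiv : ∀ᵐ t ∂(volume.restrict (Ioo 0 T)), FunctionSpaces.Torus.IsWeaklyDivFree (b t))
    {w₀ : UnitAddTorus d → EuclideanSpace ℝ d} (hw₀ : MemLp w₀ 2 volume) :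
    ∃ U : Lp (PiLp 2 (fun _ : Option d => EuclideanSpace ℝ d)) 2
        (((volume : Measure ℝ).restrict (Ioo 0 T)).prod (volume : Measure (UnitAddTorus d))),
      U ∈ (Submodule.span ℝ {f : Lp (PiLp 2 (fun _ : Option d => EuclideanSpace ℝ d)) 2
            (((volume : Measure ℝ).restrict (Ioo 0 T)).prod (volume : Measure (UnitAddTorus d))) |
          ∃ ψ : ℝ → UnitAddTorus d → EuclideanSpace ℝ d, FunctionSpaces.Torus.IsSpaceTimeTest T ψ ∧
            FunctionSpaces.Torus.IsDivFreeTest ψ ∧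
            (f : ℝ × UnitAddTorus d → PiLp 2 (fun _ : Option d => EuclideanSpace ℝ d))
              =ᵐ[((volume : Measure ℝ).restrict (Ioo 0 T)).prod volume]
              fun p => WithLp.toLp 2 (fun o : Option d =>
                o.elim (ψ p.1 p.2) (fun c => FunctionSpaces.Torus.partialDeriv c (ψ p.1) p.2))}).topologicalClosure ∧
      ∀ ψ : ℝ → UnitAddTorus d → EuclideanSpace ℝ d, FunctionSpaces.Torus.IsSpaceTimeTest T ψ →
        FunctionSpaces.Torus.IsDivFreeTest ψ →
        (∫ p, ⟪(U : ℝ × UnitAddTorus d → PiLp 2 (fun _ : Option d => EuclideanSpace ℝ d)) p none,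
            FunctionSpaces.Torus.timeDeriv ψ p.1 p.2 - ψ p.1 p.2 + FunctionSpaces.Torus.convect (b p.1) (ψ p.1) p.2 +
              viscAdjVar (𝔹 p.1) (ψ p.1) p.2⟫_ℝ ∂(((volume : Measure ℝ).restrict (Ioo 0 T)).prod volume)) +
          ∫ x, ⟪w₀ x, ψ 0 x⟫_ℝ = 0 := by
  set μ : Measure (ℝ × UnitAddTorus d) := ((volume : Measure ℝ).restrict (Ioo 0 T)).prod volume with hμ
  set lo' : ℝ := lo - (Fintype.card d : ℝ) ^ 2 * δ with hlo'
  have hlo'0 : 0 < lo' := sub_pos.2 hlo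
  -- ### the test space as a real vector space
  let S : Submodule ℝ (ℝ → UnitAddTorus d → EuclideanSpace ℝ d) :=
    { carrier := {ψ | FunctionSpaces.Torus.IsSpaceTimeTest T ψ ∧ FunctionSpaces.Torus.IsDivFreeTest ψ}
      add_mem' := fun {ψ χ} hψ hχ => ⟨hψ.1.add hχ.1, fun t =>
        isDivFree_add₃₀ (hψ.1.isSmooth_slice t) (hχ.1.isSmooth_slice t) (hψ.2 t) (hχ.2 t)⟩
      zero_mem' := ⟨FunctionSpaces.Torus.isSpaceTimeTest_zero T, fun t => isDivFree_zero₃₀⟩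
      smul_mem' := fun c ψ hψ => ⟨hψ.1.smul c, fun t => isDivFree_const_smul₃₀ (hψ.2 t) c⟩ }
  have hS : ∀ ψ : S, FunctionSpaces.Torus.IsSpaceTimeTest T (ψ : ℝ → UnitAddTorus d → EuclideanSpace ℝ d) ∧
      FunctionSpaces.Torus.IsDivFreeTest (ψ : ℝ → UnitAddTorus d → EuclideanSpace ℝ d) := fun ψ => ψ.2
  -- ### the graph embedding `j ψ = (ψ, ∇ψ)` into `L²(μ; G)`, `G = Π₂_{Option d} ℝ^d`
  set jfun : (ℝ → UnitAddTorus d → EuclideanSpace ℝ d) → ℝ × UnitAddTorus d →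
      PiLp 2 (fun _ : Option d => EuclideanSpace ℝ d) := fun ψ p =>
    WithLp.toLp 2 (fun o : Option d => o.elim (ψ p.1 p.2) (fun c => FunctionSpaces.Torus.partialDeriv c (ψ p.1) p.2))
    with hjfun
  have jfun_none : ∀ ψ p, jfun ψ p none = ψ p.1 p.2 := fun ψ p => by
    simp only [hjfun, PiLp.toLp_apply, Option.elim]
  have jfun_some : ∀ ψ p c, jfun ψ p (some c) = FunctionSpaces.Torus.partialDeriv c (ψ p.1) p.2 := fun ψ p c => by
    simp only [hjfun, PiLp.toLp_apply, Option.elim]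
  have jcont : ∀ ψ : S, Continuous (jfun (ψ : ℝ → UnitAddTorus d → EuclideanSpace ℝ d)) := by
    intro ψ
    obtain ⟨hψ, -⟩ := hS ψ
    refine (PiLp.continuous_toLp 2 _).comp (continuous_pi fun o => ?_)
    cases o with
    | none => exact hψ.continuous_uncurry
    | some c => exact hψ.continuous_uncurry_lineDeriv (EuclideanSpace.single c 1)
  have memj : ∀ ψ : S, MemLp (jfun (ψ : ℝ → UnitAddTorus d → EuclideanSpace ℝ d)) 2 μ := fun ψ =>
    memLp_two_of_continuous_slab (jcont ψ)
  let j₀ : S → Lp (PiLp 2 (fun _ : Option d => EuclideanSpace ℝ d)) 2 μ := fun ψ => (memj ψ).toLp _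
  let Fsub : Submodule ℝ (Lp (PiLp 2 (fun _ : Option d => EuclideanSpace ℝ d)) 2 μ) :=
    (Submodule.span ℝ (Set.range j₀)).topologicalClosure
  haveI hFclosed : IsClosed (Fsub : Set (Lp (PiLp 2 (fun _ : Option d => EuclideanSpace ℝ d)) 2 μ)) :=
    Submodule.isClosed_topologicalClosure _
  haveI : CompleteSpace Fsub := hFclosed.completeSpace_coe
  have hj₀mem : ∀ ψ, j₀ ψ ∈ Fsub := fun ψ =>
    Submodule.le_topologicalClosure _ (Submodule.subset_span ⟨ψ, rfl⟩)
  have hj₀add : ∀ ψ χ : S, j₀ (ψ + χ) = j₀ ψ + j₀ χ := by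
    intro ψ χ
    rw [← MemLp.toLp_add]
    refine (MemLp.toLp_eq_toLp_iff _ _).2 (ae_of_all _ fun p => ?_)
    have hψ1 : FunctionSpaces.Torus.IsContDiff 1 ((ψ : ℝ → UnitAddTorus d → EuclideanSpace ℝ d) p.1) :=
      ((hS ψ).1.isSmooth_slice p.1).isContDiff (by simp)
    have hχ1 : FunctionSpaces.Torus.IsContDiff 1 ((χ : ℝ → UnitAddTorus d → EuclideanSpace ℝ d) p.1) :=
      ((hS χ).1.isSmooth_slice p.1).isContDiff (by simp)
    ext o i
    cases o with
    | none => simp only [hjfun, PiLp.toLp_apply, Option.elim, Pi.add_apply, PiLp.add_apply, Submodule.coe_add]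
    | some c =>
      simp only [hjfun, PiLp.toLp_apply, Option.elim, Pi.add_apply, PiLp.add_apply, Submodule.coe_add]
      rw [show ((ψ : ℝ → UnitAddTorus d → EuclideanSpace ℝ d) p.1 + (χ : ℝ → UnitAddTorus d → EuclideanSpace ℝ d) p.1) =
        (ψ : ℝ → UnitAddTorus d → EuclideanSpace ℝ d) p.1 + (χ : ℝ → UnitAddTorus d → EuclideanSpace ℝ d) p.1 from rfl,
        FunctionSpaces.Torus.partialDeriv_add hψ1 hχ1, Pi.add_apply, PiLp.add_apply]
  have hj₀smul : ∀ (c : ℝ) (ψ : S), j₀ (c • ψ) = c • j₀ ψ := by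
    intro c ψ
    rw [← MemLp.toLp_const_smul]
    refine (MemLp.toLp_eq_toLp_iff _ _).2 (ae_of_all _ fun p => ?_)
    have hψ1 : FunctionSpaces.Torus.IsContDiff 1 ((ψ : ℝ → UnitAddTorus d → EuclideanSpace ℝ d) p.1) :=
      ((hS ψ).1.isSmooth_slice p.1).isContDiff (by simp)
    ext o i
    cases o with
    | none => simp only [hjfun, PiLp.toLp_apply, Option.elim, Pi.smul_apply, PiLp.smul_apply, Submodule.coe_smul, smul_eq_mul]
    | some c' =>
      simp only [hjfun, PiLp.toLp_apply, Option.elim, Pi.smul_apply, PiLp.smul_apply, Submodule.coe_smul]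
      rw [show (c • (ψ : ℝ → UnitAddTorus d → EuclideanSpace ℝ d) p.1) = c • (ψ : ℝ → UnitAddTorus d → EuclideanSpace ℝ d) p.1 from rfl,
        FunctionSpaces.Torus.partialDeriv_const_smul hψ1 c c', Pi.smul_apply, PiLp.smul_apply]
  let j : S →ₗ[ℝ] Fsub :=
    { toFun := fun ψ => ⟨j₀ ψ, hj₀mem ψ⟩
      map_add' := fun ψ χ => Subtype.ext (hj₀add ψ χ)
      map_smul' := fun c ψ => Subtype.ext (hj₀smul c ψ) }
  -- ### the value projection `P : L²(μ; G) → L²(μ; ℝ^d)`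
  set P : Lp (PiLp 2 (fun _ : Option d => EuclideanSpace ℝ d)) 2 μ →L[ℝ] Lp (EuclideanSpace ℝ d) 2 μ :=
    ContinuousLinearMap.compLpL 2 μ (PiLp.proj (𝕜 := ℝ) 2 (fun _ : Option d => EuclideanSpace ℝ d) none) with hP
  have hPcoe : ∀ U : Lp (PiLp 2 (fun _ : Option d => EuclideanSpace ℝ d)) 2 μ,
      ∀ᵐ p ∂μ, (P U : ℝ × UnitAddTorus d → EuclideanSpace ℝ d) p =
        (U : ℝ × UnitAddTorus d → PiLp 2 (fun _ : Option d => EuclideanSpace ℝ d)) p none := by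
    intro U
    filter_upwards [ContinuousLinearMap.coeFn_compLpL (PiLp.proj (𝕜 := ℝ) 2 (fun _ : Option d => EuclideanSpace ℝ d) none) U]
      with p hp
    rw [hP, hp]
    rfl
  have hPj : ∀ ψ : S, ∀ᵐ p ∂μ, (P (j₀ ψ) : ℝ × UnitAddTorus d → EuclideanSpace ℝ d) p =
      (ψ : ℝ → UnitAddTorus d → EuclideanSpace ℝ d) p.1 p.2 := by
    intro ψ
    filter_upwards [hPcoe (j₀ ψ), (memj ψ).coeFn_toLp] with p hp hq
    rw [hp, show ((j₀ ψ : Lp _ 2 μ) : ℝ × UnitAddTorus d → PiLp 2 (fun _ : Option d => EuclideanSpace ℝ d)) p =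
      jfun _ p from hq, jfun_none]
  -- ### the images of the tests under the damped operator
  set Lop : (ℝ → UnitAddTorus d → EuclideanSpace ℝ d) → ℝ × UnitAddTorus d → EuclideanSpace ℝ d := fun ψ p =>
    FunctionSpaces.Torus.timeDeriv ψ p.1 p.2 - ψ p.1 p.2 + FunctionSpaces.Torus.convect (b p.1) (ψ p.1) p.2 +
      viscAdjVar (𝔹 p.1) (ψ p.1) p.2 with hLop
  have memK : ∀ ψ : S, MemLp (Lop (ψ : ℝ → UnitAddTorus d → EuclideanSpace ℝ d)) 2 μ := fun ψ =>
    memLp_two_dampedOpVar h𝔹s h𝔹c h𝔹d (hS ψ).1 hbm hbM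
  let K₀ : S → Lp (EuclideanSpace ℝ d) 2 μ := fun ψ => (memK ψ).toLp _
  have hK₀add : ∀ ψ χ : S, K₀ (ψ + χ) = K₀ ψ + K₀ χ := by
    intro ψ χ
    rw [← MemLp.toLp_add]
    refine (MemLp.toLp_eq_toLp_iff _ _).2 (ae_of_all _ fun p => ?_)
    exact dampedOpVar_add h𝔹s (hS ψ).1 (hS χ).1 p
  have hK₀smul : ∀ (c : ℝ) (ψ : S), K₀ (c • ψ) = c • K₀ ψ := by
    intro c ψ
    rw [← MemLp.toLp_const_smul]
    refine (MemLp.toLp_eq_toLp_iff _ _).2 (ae_of_all _ fun p => ?_)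
    exact dampedOpVar_const_smul 𝔹 (hS ψ).1 c p
  -- ### the bilinear form `E(U, ψ) = -⟪K₀ ψ, P U⟫`
  let E : Fsub →ₗ[ℝ] S →ₗ[ℝ] ℝ := LinearMap.mk₂ ℝ
    (fun u ψ => -⟪K₀ ψ, P (u : Lp (PiLp 2 (fun _ : Option d => EuclideanSpace ℝ d)) 2 μ)⟫_ℝ)
    (fun u u' ψ => by simp only [Submodule.coe_add, map_add, inner_add_right, neg_add])
    (fun c u ψ => by simp only [Submodule.coe_smul, map_smul, inner_smul_right, smul_eq_mul, mul_neg])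
    (fun u ψ χ => by rw [hK₀add, inner_add_left, neg_add])
    (fun c u ψ => by rw [hK₀smul, real_inner_smul_left, smul_eq_mul, mul_neg])
  have hE : ∀ ψ : S, ∃ Kc : ℝ, ∀ u : Fsub, |E u ψ| ≤ Kc * ‖u‖ := by
    intro ψ
    refine ⟨‖K₀ ψ‖ * ‖P‖, fun u => ?_⟩
    show |-⟪K₀ ψ, P (u : Lp (PiLp 2 (fun _ : Option d => EuclideanSpace ℝ d)) 2 μ)⟫_ℝ| ≤ ‖K₀ ψ‖ * ‖P‖ * ‖u‖
    rw [abs_neg]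
    calc |⟪K₀ ψ, P (u : Lp (PiLp 2 (fun _ : Option d => EuclideanSpace ℝ d)) 2 μ)⟫_ℝ|
        ≤ ‖K₀ ψ‖ * ‖P (u : Lp (PiLp 2 (fun _ : Option d => EuclideanSpace ℝ d)) 2 μ)‖ := abs_real_inner_le_norm _ _
      _ ≤ ‖K₀ ψ‖ * (‖P‖ * ‖(u : Lp (PiLp 2 (fun _ : Option d => EuclideanSpace ℝ d)) 2 μ)‖) :=
          mul_le_mul_of_nonneg_left (P.le_opNorm _) (norm_nonneg _)
      _ = ‖K₀ ψ‖ * ‖P‖ * ‖u‖ := by rw [Submodule.coe_norm, mul_assoc]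
  -- ### the size function (with the gradient term) and the embedding bound
  let q : S → ℝ := fun ψ => Real.sqrt ((∫ t in Ioo 0 T, ∫ x, ‖(ψ : ℝ → UnitAddTorus d → EuclideanSpace ℝ d) t x‖ ^ 2) +
    lo' * (∫ t in Ioo 0 T, FunctionSpaces.Torus.gradNormSq ((ψ : ℝ → UnitAddTorus d → EuclideanSpace ℝ d) t)) +
    (1 / 2) * ∫ x, ‖(ψ : ℝ → UnitAddTorus d → EuclideanSpace ℝ d) 0 x‖ ^ 2)
  have hq : ∀ ψ, 0 ≤ q ψ := fun ψ => Real.sqrt_nonneg _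
  -- the three pieces are nonnegative
  have hA0 : ∀ ψ : S, 0 ≤ ∫ t in Ioo 0 T, ∫ x, ‖(ψ : ℝ → UnitAddTorus d → EuclideanSpace ℝ d) t x‖ ^ 2 :=
    fun ψ => setIntegral_nonneg measurableSet_Ioo fun t _ => integral_nonneg fun x => sq_nonneg _
  have hG0 : ∀ ψ : S, 0 ≤ ∫ t in Ioo 0 T, FunctionSpaces.Torus.gradNormSq ((ψ : ℝ → UnitAddTorus d → EuclideanSpace ℝ d) t) :=
    fun ψ => setIntegral_nonneg measurableSet_Ioo fun t _ => FunctionSpaces.Torus.gradNormSq_nonneg _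
  have hD0 : ∀ ψ : S, 0 ≤ (1 / 2) * ∫ x, ‖(ψ : ℝ → UnitAddTorus d → EuclideanSpace ℝ d) 0 x‖ ^ 2 :=
    fun ψ => mul_nonneg (by norm_num) (integral_nonneg fun x => sq_nonneg _)
  -- ‖j₀ ψ‖² = ∫∫‖ψ‖² + ∫ ‖∇ψ‖²
  have hnormj : ∀ ψ : S, ‖j₀ ψ‖ ^ 2 =
      (∫ t in Ioo 0 T, ∫ x, ‖(ψ : ℝ → UnitAddTorus d → EuclideanSpace ℝ d) t x‖ ^ 2) +
        ∫ t in Ioo 0 T, FunctionSpaces.Torus.gradNormSq ((ψ : ℝ → UnitAddTorus d → EuclideanSpace ℝ d) t) := by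
    intro ψ
    obtain ⟨hψ, -⟩ := hS ψ
    have h1 : ‖j₀ ψ‖ ^ 2 = ∫ p, ‖jfun (ψ : ℝ → UnitAddTorus d → EuclideanSpace ℝ d) p‖ ^ 2 ∂μ := by
      rw [← real_inner_self_eq_norm_sq, MeasureTheory.L2.inner_def]
      refine integral_congr_ae ?_
      filter_upwards [(memj ψ).coeFn_toLp] with p hp
      rw [show (j₀ ψ : ℝ × UnitAddTorus d → PiLp 2 (fun _ : Option d => EuclideanSpace ℝ d)) p = jfun _ p from hp,
        real_inner_self_eq_norm_sq]
    have hpt : ∀ p, ‖jfun (ψ : ℝ → UnitAddTorus d → EuclideanSpace ℝ d) p‖ ^ 2 =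
        ‖(ψ : ℝ → UnitAddTorus d → EuclideanSpace ℝ d) p.1 p.2‖ ^ 2 +
          ∑ c, ‖FunctionSpaces.Torus.partialDeriv c ((ψ : ℝ → UnitAddTorus d → EuclideanSpace ℝ d) p.1) p.2‖ ^ 2 := by
      intro p
      rw [PiLp.norm_sq_eq_of_L2, Fintype.sum_option]
      simp only [jfun_none, jfun_some]
    -- integrability of the two summands on `μ`
    have iV : Integrable (fun p : ℝ × UnitAddTorus d => ‖(ψ : ℝ → UnitAddTorus d → EuclideanSpace ℝ d) p.1 p.2‖ ^ 2) μ :=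
      hψ.memLp_two_uncurry.integrable_norm_pow two_ne_zero
    have iD : Integrable (fun p : ℝ × UnitAddTorus d =>
        ∑ c, ‖FunctionSpaces.Torus.partialDeriv c ((ψ : ℝ → UnitAddTorus d → EuclideanSpace ℝ d) p.1) p.2‖ ^ 2) μ := by
      refine integrable_finsetSum _ fun c _ => ?_
      have hc : Continuous (uncurry fun t x =>
          FunctionSpaces.Torus.partialDeriv c ((ψ : ℝ → UnitAddTorus d → EuclideanSpace ℝ d) t) x) :=
        hψ.continuous_uncurry_lineDeriv (EuclideanSpace.single c 1)
      exact (memLp_two_of_continuous_slab hc).integrable_norm_pow two_ne_zero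
    rw [h1, integral_congr_ae (ae_of_all _ hpt), integral_add iV iD, hμ, integral_prod _ iV, integral_prod _ iD]
    rfl
  set Cj : ℝ := Real.sqrt (max 1 (1 / lo')) with hCj
  have hCj0 : 0 ≤ Cj := Real.sqrt_nonneg _
  have hj : ∀ ψ, ‖j ψ‖ ≤ Cj * q ψ := by
    intro ψ
    show ‖(⟨j₀ ψ, hj₀mem ψ⟩ : Fsub)‖ ≤ Cj * q ψ
    rw [Submodule.coe_norm]
    have hsq : ‖j₀ ψ‖ ^ 2 ≤ (Cj * q ψ) ^ 2 := by
      rw [mul_pow, hCj, Real.sq_sqrt (by positivity), Real.sq_sqrt (by linarith [hA0 ψ, mul_nonneg hlo'0.le (hG0 ψ), hD0 ψ]),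
        hnormj ψ]
      have hm1 : (1 : ℝ) ≤ max 1 (1 / lo') := le_max_left _ _
      have hm2 : 1 / lo' ≤ max 1 (1 / lo') := le_max_right _ _
      have hG := hG0 ψ
      have hA := hA0 ψ
      have hD := hD0 ψ
      have key : ∫ t in Ioo 0 T, FunctionSpaces.Torus.gradNormSq ((ψ : ℝ → UnitAddTorus d → EuclideanSpace ℝ d) t) ≤
          max 1 (1 / lo') * (lo' * ∫ t in Ioo 0 T, FunctionSpaces.Torus.gradNormSq ((ψ : ℝ → UnitAddTorus d → EuclideanSpace ℝ d) t)) := by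
        rw [← mul_assoc]
        have : (1 : ℝ) ≤ max 1 (1 / lo') * lo' := by
          calc (1 : ℝ) = (1 / lo') * lo' := by field_simp
            _ ≤ max 1 (1 / lo') * lo' := mul_le_mul_of_nonneg_right hm2 hlo'0.le
        nlinarith
      nlinarith
    have hpos : 0 ≤ Cj * q ψ := mul_nonneg hCj0 (hq ψ)
    exact (pow_le_pow_iff_left₀ (norm_nonneg _) hpos two_ne_zero).1 hsq
  -- ### coercivity (`setIntegral_varTensorForm_ge'`)
  have hcoer : ∀ ψ : S, 1 * q ψ ^ 2 ≤ E (j ψ) ψ := by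
    intro ψ
    obtain ⟨hψ, hdiv⟩ := hS ψ
    rw [one_mul, Real.sq_sqrt (by linarith [hA0 ψ, mul_nonneg hlo'0.le (hG0 ψ), hD0 ψ])]
    show (∫ t in Ioo 0 T, ∫ x, ‖(ψ : ℝ → UnitAddTorus d → EuclideanSpace ℝ d) t x‖ ^ 2) +
        lo' * (∫ t in Ioo 0 T, FunctionSpaces.Torus.gradNormSq ((ψ : ℝ → UnitAddTorus d → EuclideanSpace ℝ d) t)) +
        (1 / 2) * ∫ x, ‖(ψ : ℝ → UnitAddTorus d → EuclideanSpace ℝ d) 0 x‖ ^ 2 ≤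
      -⟪K₀ ψ, P (j₀ ψ)⟫_ℝ
    -- the `L²(μ)` inner product as a space–time integral
    have hinner : ⟪K₀ ψ, P (j₀ ψ)⟫_ℝ = ∫ p, ⟪(ψ : ℝ → UnitAddTorus d → EuclideanSpace ℝ d) p.1 p.2,
        Lop (ψ : ℝ → UnitAddTorus d → EuclideanSpace ℝ d) p⟫_ℝ ∂μ := by
      rw [MeasureTheory.L2.inner_def]
      refine integral_congr_ae ?_
      filter_upwards [(memK ψ).coeFn_toLp, hPj ψ] with p hp hq'
      rw [show (K₀ ψ : ℝ × UnitAddTorus d → EuclideanSpace ℝ d) p = Lop _ p from hp, hq', real_inner_comm]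
    have hprod : ∫ p, ⟪(ψ : ℝ → UnitAddTorus d → EuclideanSpace ℝ d) p.1 p.2,
        Lop (ψ : ℝ → UnitAddTorus d → EuclideanSpace ℝ d) p⟫_ℝ ∂μ =
        ∫ t in Ioo 0 T, ∫ x, ⟪(ψ : ℝ → UnitAddTorus d → EuclideanSpace ℝ d) t x,
          FunctionSpaces.Torus.timeDeriv (ψ : ℝ → UnitAddTorus d → EuclideanSpace ℝ d) t x -
            (ψ : ℝ → UnitAddTorus d → EuclideanSpace ℝ d) t x +
            FunctionSpaces.Torus.convect (b t) ((ψ : ℝ → UnitAddTorus d → EuclideanSpace ℝ d) t) x +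
            viscAdjVar (𝔹 t) ((ψ : ℝ → UnitAddTorus d → EuclideanSpace ℝ d) t) x⟫_ℝ := by
      have hm2 : MemLp (uncurry (ψ : ℝ → UnitAddTorus d → EuclideanSpace ℝ d)) 2 μ := hψ.memLp_two_uncurry
      have hint : Integrable (fun p : ℝ × UnitAddTorus d => ⟪(ψ : ℝ → UnitAddTorus d → EuclideanSpace ℝ d) p.1 p.2,
          Lop (ψ : ℝ → UnitAddTorus d → EuclideanSpace ℝ d) p⟫_ℝ) μ := by
        refine Integrable.mono' (((hm2.integrable_norm_pow two_ne_zero).add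
          ((memK ψ).integrable_norm_pow two_ne_zero)).div_const 2) (hm2.1.inner (memK ψ).1)
          (ae_of_all _ fun p => ?_)
        rw [Real.norm_eq_abs]
        have h := abs_real_inner_le_norm ((ψ : ℝ → UnitAddTorus d → EuclideanSpace ℝ d) p.1 p.2)
          (Lop (ψ : ℝ → UnitAddTorus d → EuclideanSpace ℝ d) p)
        have h2 : ‖(ψ : ℝ → UnitAddTorus d → EuclideanSpace ℝ d) p.1 p.2‖ *
            ‖Lop (ψ : ℝ → UnitAddTorus d → EuclideanSpace ℝ d) p‖ ≤
            (‖uncurry (ψ : ℝ → UnitAddTorus d → EuclideanSpace ℝ d) p‖ ^ 2 +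
              ‖Lop (ψ : ℝ → UnitAddTorus d → EuclideanSpace ℝ d) p‖ ^ 2) / 2 := by
          have : ‖uncurry (ψ : ℝ → UnitAddTorus d → EuclideanSpace ℝ d) p‖ =
              ‖(ψ : ℝ → UnitAddTorus d → EuclideanSpace ℝ d) p.1 p.2‖ := rfl
          rw [this]
          nlinarith [sq_nonneg (‖(ψ : ℝ → UnitAddTorus d → EuclideanSpace ℝ d) p.1 p.2‖ -
            ‖Lop (ψ : ℝ → UnitAddTorus d → EuclideanSpace ℝ d) p‖)]
        exact h.trans h2
      rw [hμ, integral_prod _ hint]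
    rw [hinner, hprod, hlo']
    exact setIntegral_varTensorForm_ge' hT h𝔸 h𝔹s h𝔹c h𝔹d hδ hψ hdiv hbdiv hbm hbM
  -- ### the datum functional
  have hintL : ∀ ψ : S, Integrable (fun x => ⟪w₀ x, (ψ : ℝ → UnitAddTorus d → EuclideanSpace ℝ d) 0 x⟫_ℝ) volume :=
    fun ψ => FunctionSpaces.Torus.integrable_inner_of_continuous (hw₀.integrable one_le_two)
      ((hS ψ).1.isSmooth_slice 0).continuous
  let L : S →ₗ[ℝ] ℝ :=
    { toFun := fun ψ => ∫ x, ⟪w₀ x, (ψ : ℝ → UnitAddTorus d → EuclideanSpace ℝ d) 0 x⟫_ℝ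
      map_add' := fun ψ χ => by
        show ∫ x, ⟪w₀ x, ((ψ : ℝ → UnitAddTorus d → EuclideanSpace ℝ d) + χ) 0 x⟫_ℝ = _
        simp only [Pi.add_apply, inner_add_right]
        exact integral_add (hintL ψ) (hintL χ)
      map_smul' := fun c ψ => by
        show ∫ x, ⟪w₀ x, (c • (ψ : ℝ → UnitAddTorus d → EuclideanSpace ℝ d)) 0 x⟫_ℝ = _
        simp only [Pi.smul_apply, real_inner_smul_right, integral_const_mul, smul_eq_mul, RingHom.id_apply] }
  have hL : ∀ ψ : S, |L ψ| ≤ Real.sqrt 2 * Real.sqrt (∫ x, ‖w₀ x‖ ^ 2) * q ψ := by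
    intro ψ
    show |∫ x, ⟪w₀ x, (ψ : ℝ → UnitAddTorus d → EuclideanSpace ℝ d) 0 x⟫_ℝ| ≤ _
    have hψ0 : MemLp ((ψ : ℝ → UnitAddTorus d → EuclideanSpace ℝ d) 0) 2 volume :=
      ((hS ψ).1.isSmooth_slice 0).continuous.memLp_of_hasCompactSupport (HasCompactSupport.of_compactSpace _)
    have hcs : |∫ x, ⟪w₀ x, (ψ : ℝ → UnitAddTorus d → EuclideanSpace ℝ d) 0 x⟫_ℝ| ≤
        Real.sqrt (∫ x, ‖w₀ x‖ ^ 2) * Real.sqrt (∫ x, ‖(ψ : ℝ → UnitAddTorus d → EuclideanSpace ℝ d) 0 x‖ ^ 2) := by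
      calc |∫ x, ⟪w₀ x, (ψ : ℝ → UnitAddTorus d → EuclideanSpace ℝ d) 0 x⟫_ℝ|
          ≤ ∫ x, |⟪w₀ x, (ψ : ℝ → UnitAddTorus d → EuclideanSpace ℝ d) 0 x⟫_ℝ| := abs_integral_le_integral_abs
        _ ≤ ∫ x, ‖w₀ x‖ * ‖(ψ : ℝ → UnitAddTorus d → EuclideanSpace ℝ d) 0 x‖ :=
            integral_mono_of_nonneg (ae_of_all _ fun x => abs_nonneg _)
              (by
                obtain ⟨C, hC⟩ := (isCompact_univ.image ((hS ψ).1.isSmooth_slice 0).continuous).isBounded.exists_norm_le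
                have hC' : ∀ x, ‖(ψ : ℝ → UnitAddTorus d → EuclideanSpace ℝ d) 0 x‖ ≤ C := fun x => hC _ ⟨x, mem_univ _, rfl⟩
                exact ((hw₀.integrable one_le_two).norm.mul_const C).mono'
                  ((hw₀.integrable one_le_two).norm.aestronglyMeasurable.mul hψ0.1.norm)
                  (ae_of_all _ fun x => by
                    rw [Real.norm_eq_abs, abs_of_nonneg (mul_nonneg (norm_nonneg _) (norm_nonneg _))]
                    exact mul_le_mul_of_nonneg_left (hC' x) (norm_nonneg _)))
              (ae_of_all _ fun x => abs_real_inner_le_norm _ _)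
        _ ≤ _ := FunctionSpaces.Torus.integral_norm_mul_norm_le_sqrt_sq_mul_sqrt_sq hw₀ hψ0
    have hq2 : Real.sqrt (∫ x, ‖(ψ : ℝ → UnitAddTorus d → EuclideanSpace ℝ d) 0 x‖ ^ 2) ≤ Real.sqrt 2 * q ψ := by
      rw [← Real.sqrt_mul (by norm_num : (0:ℝ) ≤ 2)]
      refine Real.sqrt_le_sqrt ?_
      have hA := hA0 ψ
      have hG := mul_nonneg hlo'0.le (hG0 ψ)
      show ∫ x, ‖(ψ : ℝ → UnitAddTorus d → EuclideanSpace ℝ d) 0 x‖ ^ 2 ≤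
        2 * ((∫ t in Ioo 0 T, ∫ x, ‖(ψ : ℝ → UnitAddTorus d → EuclideanSpace ℝ d) t x‖ ^ 2) +
          lo' * (∫ t in Ioo 0 T, FunctionSpaces.Torus.gradNormSq ((ψ : ℝ → UnitAddTorus d → EuclideanSpace ℝ d) t)) +
          (1 / 2) * ∫ x, ‖(ψ : ℝ → UnitAddTorus d → EuclideanSpace ℝ d) 0 x‖ ^ 2)
      linarith
    calc |∫ x, ⟪w₀ x, (ψ : ℝ → UnitAddTorus d → EuclideanSpace ℝ d) 0 x⟫_ℝ|
        ≤ Real.sqrt (∫ x, ‖w₀ x‖ ^ 2) * (Real.sqrt 2 * q ψ) :=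
          hcs.trans (mul_le_mul_of_nonneg_left hq2 (Real.sqrt_nonneg _))
      _ = Real.sqrt 2 * Real.sqrt (∫ x, ‖w₀ x‖ ^ 2) * q ψ := by ring
  -- ### Lions' theorem
  obtain ⟨u, hu⟩ := Literature.Analysis.OperatorTheory.exists_eq_of_coercive j q hq hCj0 hj E hE one_pos hcoer L
    (by positivity) hL
  refine ⟨(u : Lp (PiLp 2 (fun _ : Option d => EuclideanSpace ℝ d)) 2 μ), ?_, fun ψ hψ hdiv => ?_⟩
  · -- membership: `Fsub` is contained in the closure of the span of the advertised set
    have hsub : Set.range j₀ ⊆ {f : Lp (PiLp 2 (fun _ : Option d => EuclideanSpace ℝ d)) 2 μ |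
        ∃ ψ : ℝ → UnitAddTorus d → EuclideanSpace ℝ d, FunctionSpaces.Torus.IsSpaceTimeTest T ψ ∧
          FunctionSpaces.Torus.IsDivFreeTest ψ ∧
          (f : ℝ × UnitAddTorus d → PiLp 2 (fun _ : Option d => EuclideanSpace ℝ d)) =ᵐ[μ]
            fun p => WithLp.toLp 2 (fun o : Option d =>
              o.elim (ψ p.1 p.2) (fun c => FunctionSpaces.Torus.partialDeriv c (ψ p.1) p.2))} := by
      rintro f ⟨ψ, rfl⟩
      exact ⟨ψ, (hS ψ).1, (hS ψ).2, (memj ψ).coeFn_toLp⟩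
    exact Submodule.topologicalClosure_mono (Submodule.span_mono hsub) u.2
  · have h := hu ⟨ψ, hψ, hdiv⟩
    -- `E u ψ = -⟪K₀ ψ, P u⟫ = L ψ = ∫⟪w₀, ψ 0⟫`
    change -⟪K₀ ⟨ψ, hψ, hdiv⟩, P (u : Lp (PiLp 2 (fun _ : Option d => EuclideanSpace ℝ d)) 2 μ)⟫_ℝ =
      ∫ x, ⟪w₀ x, ψ 0 x⟫_ℝ at h
    have hinner : ⟪K₀ ⟨ψ, hψ, hdiv⟩, P (u : Lp (PiLp 2 (fun _ : Option d => EuclideanSpace ℝ d)) 2 μ)⟫_ℝ =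
        ∫ p, ⟪(u : ℝ × UnitAddTorus d → PiLp 2 (fun _ : Option d => EuclideanSpace ℝ d)) p none, Lop ψ p⟫_ℝ ∂μ := by
      rw [MeasureTheory.L2.inner_def]
      refine integral_congr_ae ?_
      filter_upwards [(memK ⟨ψ, hψ, hdiv⟩).coeFn_toLp,
        hPcoe (u : Lp (PiLp 2 (fun _ : Option d => EuclideanSpace ℝ d)) 2 μ)] with p hp hq'
      rw [show (K₀ ⟨ψ, hψ, hdiv⟩ : ℝ × UnitAddTorus d → EuclideanSpace ℝ d) p = Lop ψ p from hp, hq', real_inner_comm]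
    rw [hinner] at h
    linarith

end Torus

end Literature.Analysis.FluidPDE

end
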